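import Mathlib
import HarnessLib
import Literature.MathematicalPhysics.QuantumFieldTheory.YangMillsOS

/-!
# Sketch — crux-ideate stmt-QuantumFields-11686 (PencilRigidity.NPointIsotropy), ideator 3, round 1

First lemmas of the two idea cards (signatures only; they must elaborate, not be proved):

* `AngularBandLimit` (card `entire-angle-band-limit`): RP in the eight planar frames + E0' + E3 +
  translations ⇒ for every off-diagonal `F`, `θ ↦ 𝔖ₙ(F ∘ R_θ⁻¹)` is a trigonometric polynomial in
  `e^{4iθ}` of degree `≤ C·(n+1)` (the complexified rotation angle is an ENTIRE variable of
  exponential type; `π/2`-periodicity from the proper hypercubic group).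
* `KernelAngularBandLimit` (same card, kernel form = dividend for ShellRigidity): under the verbatim
  hypotheses of `PencilRigidity.ShellRigidity`, `θ ↦ K(R_θ x)` has only the modes `0, 4, 8`.
* `QuarterTurnPositive` (card `quarter-turn-root`): RP across the diagonal mirror, read in the
  `e₀`-quantisation, says the hypercubic quarter-turn is a POSITIVE HERMITIAN operator on
  quadrant-supported vectors: the matrix `𝔖(θ(F_i ∘ R_q⁻¹)* ⊗ F_j)` is positive semidefinite.
-/

namespace Summit.QuantumFields.YangMills.Cruxes.NPointIsotropy.Sketch

open scoped BigOperators
open Literature.MathematicalPhysics.QuantumLattice Literature.MathematicalPhysics.AQFT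
  Literature.MathematicalPhysics.QuantumFieldTheory MeasureTheory

local notation "E" => EuclideanSpace ℝ (Fin 4)

/-- A linear isometry `R` of `ℝ⁴` is "the planar rotation by `θ`" of the `(x₀,x₁)`-plane. -/
def IsPlanarRotation (R : E ≃ₗᵢ[ℝ] E) (θ : ℝ) : Prop :=
  LinearMap.det (R.toLinearEquiv : E →ₗ[ℝ] E) = 1 ∧
    R (EuclideanSpace.single 2 1) = EuclideanSpace.single 2 1 ∧
    R (EuclideanSpace.single 3 1) = EuclideanSpace.single 3 1 ∧
    R (EuclideanSpace.single 0 1) =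
      Real.cos θ • EuclideanSpace.single 0 1 + Real.sin θ • EuclideanSpace.single 1 1

/-- RP in pull-back form for the eight planar frames `R e₀ ∈ {±e₀, ±e₁, (±e₀ ± e₁)/√2}`
(verbatim the crux's hypothesis shape). -/
def EightFrameRP (S : SchwingerFamily E) : Prop :=
  ∀ (R : E ≃ₗᵢ[ℝ] E) (a b : ℝ), a ^ 2 + b ^ 2 = 1 → (a = 0 ∨ b = 0 ∨ a ^ 2 = b ^ 2) →
    R (EuclideanSpace.single 0 1) = a • EuclideanSpace.single 0 1 + b • EuclideanSpace.single 1 1 →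
    (SchwingerFamily.toLabelled (fun n => (S n).comp (linActMulti R))).IsReflectionPositive

/-- **First lemma of card `entire-angle-band-limit` (n-point form).** Eight-frame reflection
positivity + E0' + E3 + translation invariance + proper planar quarter-turn invariance force the
angular dependence of EVERY Schwinger function under the planar rotations to be a trigonometric
polynomial in `e^{4iθ}` whose degree grows at most linearly in the number of points. -/
def AngularBandLimit : Prop :=
  ∀ (S : SchwingerFamily E), S.toLabelled.HasLinearGrowth → S.toLabelled.IsSymmetric →
    (∀ (n : ℕ) (a : E) (F : SchwartzMap (Fin n → E) ℂ), IsOffDiagonal F →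
      S n (translateMulti a F) = S n F) →
    (∀ (R : E ≃ₗᵢ[ℝ] E), IsPlanarRotation R (Real.pi / 2) →
      ∀ (n : ℕ) (F : SchwartzMap (Fin n → E) ℂ), IsOffDiagonal F → S n (linActMulti R F) = S n F) →
    EightFrameRP S →
    ∃ C : ℝ, ∀ (n : ℕ) (F : SchwartzMap (Fin n → E) ℂ), IsOffDiagonal F →
      ∃ (N : ℕ) (c : ℤ → ℂ), (N : ℝ) ≤ C * (n + 1) ∧
        ∀ (R : E ≃ₗᵢ[ℝ] E) (θ : ℝ), IsPlanarRotation R θ →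
          S n (linActMulti R F) =
            ∑ k ∈ Finset.Icc (-(N : ℤ)) N, c k * Complex.exp (4 * (k : ℂ) * (θ : ℂ) * Complex.I)

/-- **Kernel form (dividend for the sibling crux `ShellRigidity`).** Under the verbatim hypotheses
of `PencilRigidity.ShellRigidity` (continuity off 0, the sub-`|x|⁻¹⁰` bound, `W(B₄)`-invariance,
pointwise OS-positivity across `x₀ = 0` and `x₀ = x₁`), the planar angular dependence of `K` has
only the Fourier modes `0, ±4, ±8`: exponential type `≤ 10 − η < 12` of the entire function
`θ ↦ K(R_θ x)`. -/
def KernelAngularBandLimit : Prop :=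
  ∀ (K : E → ℝ), ContinuousOn K {x : E | x ≠ 0} →
    (∃ C η : ℝ, 0 < η ∧ ∀ x : E, x ≠ 0 → |K x| ≤ C * (1 + ‖x‖ ^ (η - 10))) →
    (∀ R : E ≃ₗᵢ[ℝ] E, (∀ i : Fin 4, ∃ j : Fin 4, R (EuclideanSpace.single i 1) =
        EuclideanSpace.single j 1 ∨ R (EuclideanSpace.single i 1) = -EuclideanSpace.single j 1) →
      ∀ x : E, K (R x) = K x) →
    (∀ (m : ℕ) (x : Fin m → E) (c : Fin m → ℝ), (∀ i, 0 < x i 0) →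
      0 ≤ ∑ i, ∑ j, c i * c j * K (timeReflection 4 (x i) - x j)) →
    (∀ (m : ℕ) (x : Fin m → E) (c : Fin m → ℝ), (∀ i, x i 1 < x i 0) →
      0 ≤ ∑ i, ∑ j, c i * c j *
        K (LinearIsometryEquiv.piLpCongrLeft 2 ℝ ℝ (Equiv.swap (0 : Fin 4) 1) (x i) - x j)) →
    ∀ x : E, x ≠ 0 → ∃ a b : Fin 3 → ℝ, ∀ (R : E ≃ₗᵢ[ℝ] E) (θ : ℝ), IsPlanarRotation R θ →
      K (R x) = ∑ j : Fin 3, (a j * Real.cos (4 * j * θ) + b j * Real.sin (4 * j * θ))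

/-- The quarter-turn `R_q : e₀ ↦ -e₁, e₁ ↦ e₀` (fixing `e₂, e₃`): it maps the quadrant
`{x₀ > 0, x₁ > 0}` onto `{x₀ > 0, x₁ < 0}`, inside the positive-time half-space. -/
def IsQuarterTurn (R : E ≃ₗᵢ[ℝ] E) : Prop :=
  R (EuclideanSpace.single 0 1) = -EuclideanSpace.single 1 1 ∧
    R (EuclideanSpace.single 1 1) = EuclideanSpace.single 0 1 ∧
    R (EuclideanSpace.single 2 1) = EuclideanSpace.single 2 1 ∧
    R (EuclideanSpace.single 3 1) = EuclideanSpace.single 3 1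

/-- `F` is supported in the `n`-fold quadrant `{x₀ > 0, x₁ > 0}ⁿ`. -/
def IsQuadrantSupported {n : ℕ} (F : SchwartzMap (Fin n → E) ℂ) : Prop :=
  ∀ x : Fin n → E, F x ≠ 0 → ∀ i : Fin n, 0 < x i 0 ∧ 0 < x i 1

/-- **First lemma of card `quarter-turn-root`.** Reflection positivity across the diagonal mirror
`x₀ + x₁ = 0` (one of the eight frames), rewritten in the `e₀`-quantisation by `Θ_d = θ₀ ∘ R_q⁻¹`,
says: on quadrant-supported vectors the hypercubic quarter-turn `Ψ(F) ↦ Ψ(F ∘ R_q⁻¹)` is a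
POSITIVE HERMITIAN operator — the matrix `𝔖(θ(F_i ∘ R_q⁻¹)* ⊗ F_j)` is positive semidefinite
(its `(i,i)` entries are the diagonal-frame OS form). Its Friedrichs extension `Q̄ ≥ 0` and
`M := -(2/π) log Q̄` are the candidate boost generator of the card. -/
def QuarterTurnPositive : Prop :=
  ∀ (S : SchwingerFamily E), S.toLabelled.IsSymmetric →
    (∀ (n : ℕ) (a : E) (F : SchwartzMap (Fin n → E) ℂ), IsOffDiagonal F →
      S n (translateMulti a F) = S n F) →
    EightFrameRP S →
    ∀ (Rq : E ≃ₗᵢ[ℝ] E), IsQuarterTurn Rq →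
      ∀ (N : ℕ) (deg : Fin N → ℕ) (F : (j : Fin N) → SchwartzMap (Fin (deg j) → E) ℂ)
        (c : Fin N → ℂ),
        (∀ j, IsTimeOrdered (F j)) → (∀ j, IsQuadrantSupported (F j)) →
        ∀ H : (i j : Fin N) → SchwartzMap (Fin (deg i + deg j) → E) ℂ,
          (∀ i j, IsAppendTensorOf (H i j) (osAdjoint (linActMulti Rq (F i))) (F j)) →
          let z := ∑ i, ∑ j, (starRingEnd ℂ) (c i) * c j * S (deg i + deg j) (H i j)
          0 ≤ z.re ∧ z.im = 0

end Summit.QuantumFields.YangMills.Cruxes.NPointIsotropy.Sketch
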